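import Summits.QuantumFields.QCD.Theorems.NestedDissectionSeaEarlyCrosserLawMeanCountReduction

/-!
# The mean-count law of early crossers, ∀-reg forms: `JensenDilution ⇒ MeanCountLaw`, and the crux from
# pin + mean-count law (line `accretive-coarse-jensen`, crux `EarlyCrosserLaw`, stmt-QuantumFields-13995)

Sorry-free, definition-free companion of `…EarlyCrosserLawMeanCountReduction.lean` (fixed-data arrows
`meanCountLaw_of_jensenLaw`, `dilution_of_meanCountLaw`).  Here the quantifier shells of the line's physics
statements are threaded:

* `meanCountLaw_of_jensenDilution` — the registered ∀-reg Jensen physics stub `stub_jensenDilution` (every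
  admissible regularisation, pins (b) ∧ (b″) as hypotheses, threshold loss `C`) IMPLIES its mean-count twin
  `MeanCountLaw` (same shell; conclusion `E₊[# early real crossers of the window cell and its 16 children] ≤ δ_j`,
  `Σ_{j<J} δ_j ≤ ε`);
* `EarlyCrosserLaw_of_pinnedLine_of_meanCountLaw` (Form A″: registered `stub_pinnedLine` + `MeanCountLaw` ⇒ the
  crux BY NAME) and `EarlyCrosserLaw_of_pinnedMeanCount` (Form B″: the ∃-merged single statement ⇒ the crux
  BY NAME).

With the landed `dilution_of_jensenLaw` / Form A / Form B (p91005) this records the kernel-checked lattice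
`JensenDilution ⇒ MeanCountLaw ⇒ (a′)` behind one shared pin: the planner may promote the WEAKER, canonical
counting statement (mean number of early real crossers per window cell, window-summable) instead of the Jensen
form, losing nothing of the line.
-/

noncomputable section

open scoped BigOperators Matrix ComplexConjugate
open Filter MeasureTheory Polynomial
open Literature.MathematicalPhysics.QuantumLattice Literature.MathematicalPhysics.QuantumFieldTheory
  Literature.Probability.LatticeModels
open Summit.QuantumFields.QCD.Theses.NestedDissectionSea

namespace Summit.QuantumFields.QCD.Cruxes.EarlyCrosserLaw.AccretiveCoarseJensen

open scoped Classical

/-! ## The ∀-reg physics statements: `JensenDilution ⇒ MeanCountLaw` -/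

/-- **`stub_jensenDilution` implies its mean-count twin** (same quantifier shell: every admissible
regularisation, pins (b) ∧ (b″) as hypotheses, threshold loss `C`): the registered Jensen physics stub of the
line is at least as strong as the MEAN-COUNT LAW of early real crossers. -/
theorem meanCountLaw_of_jensenDilution
    (hDil : ∀ Nf : ℕ, (Nf = 2 ∨ Nf = 3) → ∀ reg : QCDRegularisation Nf, reg.HasMassScaling →
      (reg.scheme 0 0 0).HasAsymptoticScaling →
      ∃ b₀ : ℕ, 2 ≤ b₀ ∧ ∃ ℓ : ℝ, 0 < ℓ ∧ ∃ C : ℝ, 0 ≤ C ∧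
      ∀ M₀ : ℝ, 0 ≤ M₀ → ∀ m : Fin Nf → ℝ, (∀ f, M₀ + C < m f) → ∀ R : ℝ, 0 < R →
        (∀ M : ℝ, M₀ < M → ∀ᶠ k : ℕ in Filter.atTop, ∀ S : ℕ, R ≤ reg.a k * (2 * S + 1) →
          (1 / 4 : ℝ) ≤ (∫ U, (if (fermionDet (wilsonDirac (fundamentalRep (Fin 3)) U (reg.mcrit k - reg.a k * M / reg.Zm k) 1)).re < 0 then (1 : ℝ) else 0) * (∏ f, ‖fermionDet (wilsonDirac (fundamentalRep (Fin 3)) U (reg.mcrit k + reg.a k * m f / reg.Zm k) 1)‖) ∂(wilsonMeasure (fundamentalRep (Fin 3)) (reg.β k) : Measure (GaugeConfig 4 (2 * S + 1) (Matrix.specialUnitaryGroup (Fin 3) ℂ)))) /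
            (∫ U, (∏ f, ‖fermionDet (wilsonDirac (fundamentalRep (Fin 3)) U (reg.mcrit k + reg.a k * m f / reg.Zm k) 1)‖) ∂(wilsonMeasure (fundamentalRep (Fin 3)) (reg.β k) : Measure (GaugeConfig 4 (2 * S + 1) (Matrix.specialUnitaryGroup (Fin 3) ℂ))))) →
        (∀ M : ℝ, M₀ < M → ∀ᶠ k : ℕ in Filter.atTop, ∀ S : ℕ, R ≤ reg.a k * (2 * S + 1) → reg.a k * (2 * S + 1) ≤ 2 * R →
          (∫ U, (if (fermionDet (wilsonDirac (fundamentalRep (Fin 3)) U (reg.mcrit k + reg.a k * M / reg.Zm k) 1)).re < 0 then (1 : ℝ) else 0) * (∏ f, ‖fermionDet (wilsonDirac (fundamentalRep (Fin 3)) U (reg.mcrit k + reg.a k * m f / reg.Zm k) 1)‖) ∂(wilsonMeasure (fundamentalRep (Fin 3)) (reg.β k) : Measure (GaugeConfig 4 (2 * S + 1) (Matrix.specialUnitaryGroup (Fin 3) ℂ)))) /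
            (∫ U, (∏ f, ‖fermionDet (wilsonDirac (fundamentalRep (Fin 3)) U (reg.mcrit k + reg.a k * m f / reg.Zm k) 1)‖) ∂(wilsonMeasure (fundamentalRep (Fin 3)) (reg.β k) : Measure (GaugeConfig 4 (2 * S + 1) (Matrix.specialUnitaryGroup (Fin 3) ℂ)))) ≤ (1 / 8 : ℝ)) →
        (∀ ε : ℝ, 0 < ε → ∀ᶠ k : ℕ in Filter.atTop, ∀ S : ℕ, R ≤ reg.a k * (2 * S + 1) →
          ∃ δ : ℕ → ℝ, (∀ j, 0 ≤ δ j) ∧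
            ∑ j ∈ Finset.range (Nat.log 2 (⌊ℓ / reg.a k⌋₊ / b₀) + 1), δ j ≤ ε ∧
            ∀ j < Nat.log 2 (⌊ℓ / reg.a k⌋₊ / b₀) + 1, ∀ s : Fin 4 → ℕ,
              (∀ i, b₀ * 2 ^ j ≤ s i ∧ s i < b₀ * 2 ^ (j + 2) ∧ s i ≤ 2 * S + 1 ∧
                (s i : ℝ) * reg.a k ≤ ℓ) →
              ∃ r : Fin Nf → ℝ, (∀ f, 0 < r f) ∧
                (∫ U, (∑ f, ∑ n ∈ Finset.range
                    (⌊(-(reg.mcrit k + reg.a k * m f / reg.Zm k)) / (2 * r f)⌋₊ + 1),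
                    ((Real.circleAverage (fun z : ℂ => Real.log ‖((wilsonCell U 0 (0 : TorusSite 4 (2 * S + 1)) s).charpoly).eval z‖)
                        ((((2 * (n : ℝ) + 1) * r f : ℝ)) : ℂ) (2 * r f)
                      - Real.circleAverage (fun z : ℂ => Real.log ‖((wilsonCell U 0 (0 : TorusSite 4 (2 * S + 1)) s).charpoly).eval z‖)
                        ((((2 * (n : ℝ) + 1) * r f : ℝ)) : ℂ) (r f)) +
                      ∑ ε : Fin 4 → Bool,
                        (Real.circleAverage (fun z : ℂ => Real.log ‖((wilsonCell U 0 (halfCorner s ε) (halfSides s ε)).charpoly).eval z‖)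
                        ((((2 * (n : ℝ) + 1) * r f : ℝ)) : ℂ) (2 * r f)
                      - Real.circleAverage (fun z : ℂ => Real.log ‖((wilsonCell U 0 (halfCorner s ε) (halfSides s ε)).charpoly).eval z‖)
                        ((((2 * (n : ℝ) + 1) * r f : ℝ)) : ℂ) (r f)))) *
                    (∏ f, ‖fermionDet (wilsonDirac (fundamentalRep (Fin 3)) U (reg.mcrit k + reg.a k * m f / reg.Zm k) 1)‖)
                  ∂(wilsonMeasure (fundamentalRep (Fin 3)) (reg.β k) : Measure (GaugeConfig 4 (2 * S + 1) (Matrix.specialUnitaryGroup (Fin 3) ℂ)))) /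
                (∫ U, (∏ f, ‖fermionDet (wilsonDirac (fundamentalRep (Fin 3)) U (reg.mcrit k + reg.a k * m f / reg.Zm k) 1)‖)
                  ∂(wilsonMeasure (fundamentalRep (Fin 3)) (reg.β k) : Measure (GaugeConfig 4 (2 * S + 1) (Matrix.specialUnitaryGroup (Fin 3) ℂ))))
              ≤ δ j * Real.log 2)) :
    ∀ Nf : ℕ, (Nf = 2 ∨ Nf = 3) → ∀ reg : QCDRegularisation Nf, reg.HasMassScaling →
      (reg.scheme 0 0 0).HasAsymptoticScaling →
      ∃ b₀ : ℕ, 2 ≤ b₀ ∧ ∃ ℓ : ℝ, 0 < ℓ ∧ ∃ C : ℝ, 0 ≤ C ∧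
      ∀ M₀ : ℝ, 0 ≤ M₀ → ∀ m : Fin Nf → ℝ, (∀ f, M₀ + C < m f) → ∀ R : ℝ, 0 < R →
        (∀ M : ℝ, M₀ < M → ∀ᶠ k : ℕ in Filter.atTop, ∀ S : ℕ, R ≤ reg.a k * (2 * S + 1) →
          (1 / 4 : ℝ) ≤ (∫ U, (if (fermionDet (wilsonDirac (fundamentalRep (Fin 3)) U (reg.mcrit k - reg.a k * M / reg.Zm k) 1)).re < 0 then (1 : ℝ) else 0) * (∏ f, ‖fermionDet (wilsonDirac (fundamentalRep (Fin 3)) U (reg.mcrit k + reg.a k * m f / reg.Zm k) 1)‖) ∂(wilsonMeasure (fundamentalRep (Fin 3)) (reg.β k) : Measure (GaugeConfig 4 (2 * S + 1) (Matrix.specialUnitaryGroup (Fin 3) ℂ)))) /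
            (∫ U, (∏ f, ‖fermionDet (wilsonDirac (fundamentalRep (Fin 3)) U (reg.mcrit k + reg.a k * m f / reg.Zm k) 1)‖) ∂(wilsonMeasure (fundamentalRep (Fin 3)) (reg.β k) : Measure (GaugeConfig 4 (2 * S + 1) (Matrix.specialUnitaryGroup (Fin 3) ℂ))))) →
        (∀ M : ℝ, M₀ < M → ∀ᶠ k : ℕ in Filter.atTop, ∀ S : ℕ, R ≤ reg.a k * (2 * S + 1) → reg.a k * (2 * S + 1) ≤ 2 * R →
          (∫ U, (if (fermionDet (wilsonDirac (fundamentalRep (Fin 3)) U (reg.mcrit k + reg.a k * M / reg.Zm k) 1)).re < 0 then (1 : ℝ) else 0) * (∏ f, ‖fermionDet (wilsonDirac (fundamentalRep (Fin 3)) U (reg.mcrit k + reg.a k * m f / reg.Zm k) 1)‖) ∂(wilsonMeasure (fundamentalRep (Fin 3)) (reg.β k) : Measure (GaugeConfig 4 (2 * S + 1) (Matrix.specialUnitaryGroup (Fin 3) ℂ)))) /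
            (∫ U, (∏ f, ‖fermionDet (wilsonDirac (fundamentalRep (Fin 3)) U (reg.mcrit k + reg.a k * m f / reg.Zm k) 1)‖) ∂(wilsonMeasure (fundamentalRep (Fin 3)) (reg.β k) : Measure (GaugeConfig 4 (2 * S + 1) (Matrix.specialUnitaryGroup (Fin 3) ℂ)))) ≤ (1 / 8 : ℝ)) →
        (∀ ε : ℝ, 0 < ε → ∀ᶠ k : ℕ in Filter.atTop, ∀ S : ℕ, R ≤ reg.a k * (2 * S + 1) →
          ∃ δ : ℕ → ℝ, (∀ j, 0 ≤ δ j) ∧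
            ∑ j ∈ Finset.range (Nat.log 2 (⌊ℓ / reg.a k⌋₊ / b₀) + 1), δ j ≤ ε ∧
            ∀ j < Nat.log 2 (⌊ℓ / reg.a k⌋₊ / b₀) + 1, ∀ s : Fin 4 → ℕ,
              (∀ i, b₀ * 2 ^ j ≤ s i ∧ s i < b₀ * 2 ^ (j + 2) ∧ s i ≤ 2 * S + 1 ∧
                (s i : ℝ) * reg.a k ≤ ℓ) →
              (∫ U, (∑ f, ((realSpecCount (wilsonCell U 0 (0 : TorusSite 4 (2 * S + 1)) s) (-(reg.mcrit k + reg.a k * m f / reg.Zm k)) : ℝ) +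
                    ∑ c : Fin 4 → Bool,
                      (realSpecCount (wilsonCell U 0 (halfCorner s c) (halfSides s c)) (-(reg.mcrit k + reg.a k * m f / reg.Zm k)) : ℝ))) *
                    (∏ f, ‖fermionDet (wilsonDirac (fundamentalRep (Fin 3)) U (reg.mcrit k + reg.a k * m f / reg.Zm k) 1)‖)
                  ∂(wilsonMeasure (fundamentalRep (Fin 3)) (reg.β k) : Measure (GaugeConfig 4 (2 * S + 1) (Matrix.specialUnitaryGroup (Fin 3) ℂ)))) /
                (∫ U, (∏ f, ‖fermionDet (wilsonDirac (fundamentalRep (Fin 3)) U (reg.mcrit k + reg.a k * m f / reg.Zm k) 1)‖)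
                  ∂(wilsonMeasure (fundamentalRep (Fin 3)) (reg.β k) : Measure (GaugeConfig 4 (2 * S + 1) (Matrix.specialUnitaryGroup (Fin 3) ℂ))))
              ≤ δ j) := by
  intro Nf hNf reg hms has
  obtain ⟨b₀, hb₀, ℓ, hℓ, C, hC0, hdil⟩ := hDil Nf hNf reg hms has
  refine ⟨b₀, hb₀, ℓ, hℓ, C, hC0, fun M₀ hM₀ m hmm R hR hB hB2 => ?_⟩
  exact meanCountLaw_of_jensenLaw reg b₀ ℓ m R (hdil M₀ hM₀ m hmm R hR hB hB2)

/-! ## Form A″: the crux from the shared pin and the ∀-reg mean-count law -/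

/-- **The crux from the two-sided pin and the mean-count law, Form A″** (first hypothesis = the registered
`stub_pinnedLine` verbatim; second = `MeanCountLaw`, the mean-count twin of `stub_jensenDilution`): re-base
`M₀ ↦ M₀ + C`, thread the pins, get (a′) from `dilution_of_meanCountLaw`. -/
theorem EarlyCrosserLaw_of_pinnedLine_of_meanCountLaw
    (hPin : ∀ Nf : ℕ, (Nf = 2 ∨ Nf = 3) → ∃ reg : QCDRegularisation Nf, reg.HasMassScaling ∧
      (reg.scheme 0 0 0).HasAsymptoticScaling ∧ ∃ M₀ : ℝ, 0 ≤ M₀ ∧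
      ∀ m : Fin Nf → ℝ, (∀ f, M₀ < m f) → ∃ R : ℝ, 0 < R ∧
        (∀ M : ℝ, M₀ < M → ∀ᶠ k : ℕ in Filter.atTop, ∀ S : ℕ, R ≤ reg.a k * (2 * S + 1) →
          (1 / 4 : ℝ) ≤ (∫ U, (if (fermionDet (wilsonDirac (fundamentalRep (Fin 3)) U (reg.mcrit k - reg.a k * M / reg.Zm k) 1)).re < 0 then (1 : ℝ) else 0) * (∏ f, ‖fermionDet (wilsonDirac (fundamentalRep (Fin 3)) U (reg.mcrit k + reg.a k * m f / reg.Zm k) 1)‖) ∂(wilsonMeasure (fundamentalRep (Fin 3)) (reg.β k) : Measure (GaugeConfig 4 (2 * S + 1) (Matrix.specialUnitaryGroup (Fin 3) ℂ)))) /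
            (∫ U, (∏ f, ‖fermionDet (wilsonDirac (fundamentalRep (Fin 3)) U (reg.mcrit k + reg.a k * m f / reg.Zm k) 1)‖) ∂(wilsonMeasure (fundamentalRep (Fin 3)) (reg.β k) : Measure (GaugeConfig 4 (2 * S + 1) (Matrix.specialUnitaryGroup (Fin 3) ℂ))))) ∧
        (∀ M : ℝ, M₀ < M → ∀ᶠ k : ℕ in Filter.atTop, ∀ S : ℕ, R ≤ reg.a k * (2 * S + 1) → reg.a k * (2 * S + 1) ≤ 2 * R →
          (∫ U, (if (fermionDet (wilsonDirac (fundamentalRep (Fin 3)) U (reg.mcrit k + reg.a k * M / reg.Zm k) 1)).re < 0 then (1 : ℝ) else 0) * (∏ f, ‖fermionDet (wilsonDirac (fundamentalRep (Fin 3)) U (reg.mcrit k + reg.a k * m f / reg.Zm k) 1)‖) ∂(wilsonMeasure (fundamentalRep (Fin 3)) (reg.β k) : Measure (GaugeConfig 4 (2 * S + 1) (Matrix.specialUnitaryGroup (Fin 3) ℂ)))) /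
            (∫ U, (∏ f, ‖fermionDet (wilsonDirac (fundamentalRep (Fin 3)) U (reg.mcrit k + reg.a k * m f / reg.Zm k) 1)‖) ∂(wilsonMeasure (fundamentalRep (Fin 3)) (reg.β k) : Measure (GaugeConfig 4 (2 * S + 1) (Matrix.specialUnitaryGroup (Fin 3) ℂ)))) ≤ (1 / 8 : ℝ)))
    (hMC : ∀ Nf : ℕ, (Nf = 2 ∨ Nf = 3) → ∀ reg : QCDRegularisation Nf, reg.HasMassScaling →
      (reg.scheme 0 0 0).HasAsymptoticScaling →
      ∃ b₀ : ℕ, 2 ≤ b₀ ∧ ∃ ℓ : ℝ, 0 < ℓ ∧ ∃ C : ℝ, 0 ≤ C ∧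
      ∀ M₀ : ℝ, 0 ≤ M₀ → ∀ m : Fin Nf → ℝ, (∀ f, M₀ + C < m f) → ∀ R : ℝ, 0 < R →
        (∀ M : ℝ, M₀ < M → ∀ᶠ k : ℕ in Filter.atTop, ∀ S : ℕ, R ≤ reg.a k * (2 * S + 1) →
          (1 / 4 : ℝ) ≤ (∫ U, (if (fermionDet (wilsonDirac (fundamentalRep (Fin 3)) U (reg.mcrit k - reg.a k * M / reg.Zm k) 1)).re < 0 then (1 : ℝ) else 0) * (∏ f, ‖fermionDet (wilsonDirac (fundamentalRep (Fin 3)) U (reg.mcrit k + reg.a k * m f / reg.Zm k) 1)‖) ∂(wilsonMeasure (fundamentalRep (Fin 3)) (reg.β k) : Measure (GaugeConfig 4 (2 * S + 1) (Matrix.specialUnitaryGroup (Fin 3) ℂ)))) /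
            (∫ U, (∏ f, ‖fermionDet (wilsonDirac (fundamentalRep (Fin 3)) U (reg.mcrit k + reg.a k * m f / reg.Zm k) 1)‖) ∂(wilsonMeasure (fundamentalRep (Fin 3)) (reg.β k) : Measure (GaugeConfig 4 (2 * S + 1) (Matrix.specialUnitaryGroup (Fin 3) ℂ))))) →
        (∀ M : ℝ, M₀ < M → ∀ᶠ k : ℕ in Filter.atTop, ∀ S : ℕ, R ≤ reg.a k * (2 * S + 1) → reg.a k * (2 * S + 1) ≤ 2 * R →
          (∫ U, (if (fermionDet (wilsonDirac (fundamentalRep (Fin 3)) U (reg.mcrit k + reg.a k * M / reg.Zm k) 1)).re < 0 then (1 : ℝ) else 0) * (∏ f, ‖fermionDet (wilsonDirac (fundamentalRep (Fin 3)) U (reg.mcrit k + reg.a k * m f / reg.Zm k) 1)‖) ∂(wilsonMeasure (fundamentalRep (Fin 3)) (reg.β k) : Measure (GaugeConfig 4 (2 * S + 1) (Matrix.specialUnitaryGroup (Fin 3) ℂ)))) /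
            (∫ U, (∏ f, ‖fermionDet (wilsonDirac (fundamentalRep (Fin 3)) U (reg.mcrit k + reg.a k * m f / reg.Zm k) 1)‖) ∂(wilsonMeasure (fundamentalRep (Fin 3)) (reg.β k) : Measure (GaugeConfig 4 (2 * S + 1) (Matrix.specialUnitaryGroup (Fin 3) ℂ)))) ≤ (1 / 8 : ℝ)) →
        (∀ ε : ℝ, 0 < ε → ∀ᶠ k : ℕ in Filter.atTop, ∀ S : ℕ, R ≤ reg.a k * (2 * S + 1) →
          ∃ δ : ℕ → ℝ, (∀ j, 0 ≤ δ j) ∧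
            ∑ j ∈ Finset.range (Nat.log 2 (⌊ℓ / reg.a k⌋₊ / b₀) + 1), δ j ≤ ε ∧
            ∀ j < Nat.log 2 (⌊ℓ / reg.a k⌋₊ / b₀) + 1, ∀ s : Fin 4 → ℕ,
              (∀ i, b₀ * 2 ^ j ≤ s i ∧ s i < b₀ * 2 ^ (j + 2) ∧ s i ≤ 2 * S + 1 ∧
                (s i : ℝ) * reg.a k ≤ ℓ) →
              (∫ U, (∑ f, ((realSpecCount (wilsonCell U 0 (0 : TorusSite 4 (2 * S + 1)) s) (-(reg.mcrit k + reg.a k * m f / reg.Zm k)) : ℝ) +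
                    ∑ c : Fin 4 → Bool,
                      (realSpecCount (wilsonCell U 0 (halfCorner s c) (halfSides s c)) (-(reg.mcrit k + reg.a k * m f / reg.Zm k)) : ℝ))) *
                    (∏ f, ‖fermionDet (wilsonDirac (fundamentalRep (Fin 3)) U (reg.mcrit k + reg.a k * m f / reg.Zm k) 1)‖)
                  ∂(wilsonMeasure (fundamentalRep (Fin 3)) (reg.β k) : Measure (GaugeConfig 4 (2 * S + 1) (Matrix.specialUnitaryGroup (Fin 3) ℂ)))) /
                (∫ U, (∏ f, ‖fermionDet (wilsonDirac (fundamentalRep (Fin 3)) U (reg.mcrit k + reg.a k * m f / reg.Zm k) 1)‖)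
                  ∂(wilsonMeasure (fundamentalRep (Fin 3)) (reg.β k) : Measure (GaugeConfig 4 (2 * S + 1) (Matrix.specialUnitaryGroup (Fin 3) ℂ))))
              ≤ δ j)) :
    EarlyCrosserLaw := by
  intro Nf hNf
  obtain ⟨reg, hms, has, M₀, hM₀, hm⟩ := hPin Nf hNf
  obtain ⟨b₀, hb₀, ℓ, hℓ, C, hC0, hmc⟩ := hMC Nf hNf reg hms has
  refine ⟨reg, hms, has, M₀ + C, by linarith, b₀, hb₀, ℓ, hℓ, fun m hmm => ?_⟩
  have hmm₀ : ∀ f, M₀ < m f := fun f => by have := hmm f; linarith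
  obtain ⟨R, hR, hB, hB2⟩ := hm m hmm₀
  refine ⟨R, hR, ?_, fun M hM => hB M (by linarith), fun M hM => hB2 M (by linarith)⟩
  exact dilution_of_meanCountLaw reg b₀ ℓ m R (hmc M₀ hM₀ m hmm R hR hB hB2)

/-! ## Form B″: the ∃-merged cut (one regularisation carries pins and mean-count law) -/

/-- **The crux from ONE merged physics statement, Form B″** (`PinnedMeanCount`: one admissible
regularisation, `M₀`, `b₀`, `ℓ`, and for every mass tuple above `M₀` one `R` serving (b), (b″) AND the
mean-count law at its own line — the prover of this form may DEFINE `m_crit(k)` as the parity-jump line). -/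
theorem EarlyCrosserLaw_of_pinnedMeanCount
    (h : ∀ Nf : ℕ, (Nf = 2 ∨ Nf = 3) → ∃ reg : QCDRegularisation Nf, reg.HasMassScaling ∧
      (reg.scheme 0 0 0).HasAsymptoticScaling ∧ ∃ M₀ : ℝ, 0 ≤ M₀ ∧ ∃ b₀ : ℕ, 2 ≤ b₀ ∧ ∃ ℓ : ℝ, 0 < ℓ ∧
      ∀ m : Fin Nf → ℝ, (∀ f, M₀ < m f) → ∃ R : ℝ, 0 < R ∧
        (∀ M : ℝ, M₀ < M → ∀ᶠ k : ℕ in Filter.atTop, ∀ S : ℕ, R ≤ reg.a k * (2 * S + 1) →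
          (1 / 4 : ℝ) ≤ (∫ U, (if (fermionDet (wilsonDirac (fundamentalRep (Fin 3)) U (reg.mcrit k - reg.a k * M / reg.Zm k) 1)).re < 0 then (1 : ℝ) else 0) * (∏ f, ‖fermionDet (wilsonDirac (fundamentalRep (Fin 3)) U (reg.mcrit k + reg.a k * m f / reg.Zm k) 1)‖) ∂(wilsonMeasure (fundamentalRep (Fin 3)) (reg.β k) : Measure (GaugeConfig 4 (2 * S + 1) (Matrix.specialUnitaryGroup (Fin 3) ℂ)))) /
            (∫ U, (∏ f, ‖fermionDet (wilsonDirac (fundamentalRep (Fin 3)) U (reg.mcrit k + reg.a k * m f / reg.Zm k) 1)‖) ∂(wilsonMeasure (fundamentalRep (Fin 3)) (reg.β k) : Measure (GaugeConfig 4 (2 * S + 1) (Matrix.specialUnitaryGroup (Fin 3) ℂ))))) ∧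
        (∀ M : ℝ, M₀ < M → ∀ᶠ k : ℕ in Filter.atTop, ∀ S : ℕ, R ≤ reg.a k * (2 * S + 1) → reg.a k * (2 * S + 1) ≤ 2 * R →
          (∫ U, (if (fermionDet (wilsonDirac (fundamentalRep (Fin 3)) U (reg.mcrit k + reg.a k * M / reg.Zm k) 1)).re < 0 then (1 : ℝ) else 0) * (∏ f, ‖fermionDet (wilsonDirac (fundamentalRep (Fin 3)) U (reg.mcrit k + reg.a k * m f / reg.Zm k) 1)‖) ∂(wilsonMeasure (fundamentalRep (Fin 3)) (reg.β k) : Measure (GaugeConfig 4 (2 * S + 1) (Matrix.specialUnitaryGroup (Fin 3) ℂ)))) /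
            (∫ U, (∏ f, ‖fermionDet (wilsonDirac (fundamentalRep (Fin 3)) U (reg.mcrit k + reg.a k * m f / reg.Zm k) 1)‖) ∂(wilsonMeasure (fundamentalRep (Fin 3)) (reg.β k) : Measure (GaugeConfig 4 (2 * S + 1) (Matrix.specialUnitaryGroup (Fin 3) ℂ)))) ≤ (1 / 8 : ℝ)) ∧
        (∀ ε : ℝ, 0 < ε → ∀ᶠ k : ℕ in Filter.atTop, ∀ S : ℕ, R ≤ reg.a k * (2 * S + 1) →
          ∃ δ : ℕ → ℝ, (∀ j, 0 ≤ δ j) ∧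
            ∑ j ∈ Finset.range (Nat.log 2 (⌊ℓ / reg.a k⌋₊ / b₀) + 1), δ j ≤ ε ∧
            ∀ j < Nat.log 2 (⌊ℓ / reg.a k⌋₊ / b₀) + 1, ∀ s : Fin 4 → ℕ,
              (∀ i, b₀ * 2 ^ j ≤ s i ∧ s i < b₀ * 2 ^ (j + 2) ∧ s i ≤ 2 * S + 1 ∧
                (s i : ℝ) * reg.a k ≤ ℓ) →
              (∫ U, (∑ f, ((realSpecCount (wilsonCell U 0 (0 : TorusSite 4 (2 * S + 1)) s) (-(reg.mcrit k + reg.a k * m f / reg.Zm k)) : ℝ) +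
                    ∑ c : Fin 4 → Bool,
                      (realSpecCount (wilsonCell U 0 (halfCorner s c) (halfSides s c)) (-(reg.mcrit k + reg.a k * m f / reg.Zm k)) : ℝ))) *
                    (∏ f, ‖fermionDet (wilsonDirac (fundamentalRep (Fin 3)) U (reg.mcrit k + reg.a k * m f / reg.Zm k) 1)‖)
                  ∂(wilsonMeasure (fundamentalRep (Fin 3)) (reg.β k) : Measure (GaugeConfig 4 (2 * S + 1) (Matrix.specialUnitaryGroup (Fin 3) ℂ)))) /
                (∫ U, (∏ f, ‖fermionDet (wilsonDirac (fundamentalRep (Fin 3)) U (reg.mcrit k + reg.a k * m f / reg.Zm k) 1)‖)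
                  ∂(wilsonMeasure (fundamentalRep (Fin 3)) (reg.β k) : Measure (GaugeConfig 4 (2 * S + 1) (Matrix.specialUnitaryGroup (Fin 3) ℂ))))
              ≤ δ j)) :
    EarlyCrosserLaw := by
  intro Nf hNf
  obtain ⟨reg, hms, has, M₀, hM₀, b₀, hb₀, ℓ, hℓ, hm⟩ := h Nf hNf
  refine ⟨reg, hms, has, M₀, hM₀, b₀, hb₀, ℓ, hℓ, fun m hmm => ?_⟩
  obtain ⟨R, hR, hB, hB2, hJ⟩ := hm m hmm
  exact ⟨R, hR, dilution_of_meanCountLaw reg b₀ ℓ m R hJ, hB, hB2⟩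

end Summit.QuantumFields.QCD.Cruxes.EarlyCrosserLaw.AccretiveCoarseJensen

end
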